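import Summits.BirchSwinnertonDyer.BirchSwinnertonDyer.Theses.GenusKolyvaginAtTwo
import Summits.BirchSwinnertonDyer.BirchSwinnertonDyer.Theorems.CMKolyvaginAtInertTwoCMExactDescentAtTwo
import Summits.BirchSwinnertonDyer.BirchSwinnertonDyer.Theorems.PrintX6AnticyclotomicRankZeroTwistTransport
import Literature.NumberTheory.EllipticCurves.BSDSelmerCMPConverseRankOneProofs

/-!
# Route `GenusKolyvaginAtTwo`, crux `ExactDescentAtTwo` (item stmt-BirchSwinnertonDyer-22138): the
# EXACT `2`-adic descent `#Ш(E/K)[2^∞] = 4^{M₀} ∧ BSD₂(E^{(d_K)}) ⟹ BSD₂(E)` for the RANK-ZERO member,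
# PROVED in the kernel modulo the five published named facts it consumes

HONEST FRAMING (cell `bsd-f1-sign2`, seat `bsd-line-gk2-p3`, D-0145 line
`route-BirchSwinnertonDyer-GenusKolyvaginAtTwo`, DRAFT rev 2, leaf K4 `Rank1Residual.NonCMAtTwo`):
THEOREMS ONLY — no definition, no named fact, nothing asserted, nothing booked; BSD is not proved by
this and no class of WALL row 1 is closed here (the exactness `#Ш(E/K)[2^∞] = 4^{M₀}` is the INPUT —
crux #3 `KolyvaginExactAtTwo`, item 22137, a research claim at `p = 2`; the twin's `BSD₂` is the INPUT
— crux #6 `MinimalTwinBSDTwo`, item 22985). The crux is typed WITHOUT named-fact antecedents, while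
every kernel road to it consumes STATEMENT-ONLY published facts: Gross–Zagier (`gross_zagier`; GZ86
Thm I.6.3), Kolyvagin (`kolyvagin`; Kolyvagin 1990 Thm A / Gross 1991 Thm 1.3: `y_K` non-torsion ⟹
`rank E(K) = 1` — used here only to see that the twin `E^{(d_K)}` has analytic rank EXACTLY one),
Gross–Zagier–Kolyvagin over `ℚ` (`rank_eq_analyticRank_of_analyticRank_le_one`), modularity
(`hasEntireLFunction_rat`) and Milne 1972 Thm 1 in Dokchitser–Dokchitser's any-model form
(`Milne1972.bsdQuotient_baseChange_quadratic_anyModel`). This file proves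
**`exactDescentAtTwo_of_facts : GZ → Kolyvagin → GZK → modularity → Milne → ExactDescentAtTwo`** and
the bundled twin `exactDescentAtTwo_ofFacts`: a CONDITIONAL closer (D-0014), landed `--supports … --as
helper`; the by-name closure of item 22138 needs an `…OfFacts` twin item (planner). It is the
rank-ZERO mirror of the sibling route's `CMExactDescent.cmExactDescentAtTwo_of_facts`
(`Theorems/CMKolyvaginAtInertTwoCMExactDescentAtTwo.lean`, route `CMKolyvaginAtInertTwo`, crux 22837,
where `E` is the rank-ONE member), whose §1–§4 lemmas are reused verbatim; the non-CM hypothesis,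
the odd-Tamagawa display's companion `#Sel₂(Wd) = 2` and the optimality display of `Dt` are NOT used.

The argument (Gross–Zagier V.§2 over `K`, exact at `2`), `V = W ⊗ K`, `E` of analytic rank `0`:
(§2, CM file) `P(1) = Tr y(1)` descends to `P₀ ∈ E(K)` over the Heegner point of THE ITEM'S datum
`Dt` (Gross 1991 §4; Shimura reciprocity at conductor `1`, tree theorem
`heegnerPointOfConductor_one_galoisConj_holds`); `P₀` is non-torsion (as `P(1)` is);
(ranks) Gross–Zagier gives `L′(E/K,1) ≠ 0`; Kolyvagin gives `rank E(K) = 1`, GZK gives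
`rank E(ℚ) = 0`, so `rank E^{(d_K)}(ℚ) = 1` (`mordellWeilRank_baseChange_quadratic_holds`), hence
`L(E^{(d_K)},1) = 0` (else GZK would give rank `0`), hence `L′(E/K,1) = L(E,1)·L′(E^{(d_K)},1) ≠ 0`
(tree `AnticyclotomicRankZero.lDerivEK_eq_mul_deriv`) forces `ord_{s=1} L(E^{(d_K)},s) = 1` (`analyticRank_eq_one_of_entireLFunction_one_eq_zero_of_deriv_ne_zero`)
and `ord_{s=1} L(E_K,s) = 1` (`P2.analyticRank_baseChange_eq_one_iff`);
(§3, CM file) `E(K[1])[2] = 0` (tree theorem `Uniform.U2.RingClass.forall_two_nsmul_eq_zero_of_heegner`,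
from `E(ℚ)[2] = 0`, which `ρ̄_{E,2}` onto gives), so `2^M ∣ P(1)` in `E(K[1])` iff `2^M ∣ P₀` in
`E(K)` (McCallum Lemma 5.1, `X11b.Three.Koly.pDiv_one_iff_exists_zsmul_eq`) and `ord₂[E(K):ℤP₀] = M₀`
(`Koly.padicValNat_index_zmultiples_eq_of_divisibility`);
(§4, CM file) `#Ш_an(V) = 4·I²/(c²·w_K²·(∏_ℓ c_ℓ)²)` EXACTLY in Dokchitser–Dokchitser's currency
(`CMExactDescent.shaAnOverC_baseChange_eq_of_heegner`, from Gross–Zagier; no `2`-power dropped);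
(§5) `w_K = 2` (`d_K` odd, `≠ −3` ⟹ `d_K < −4`), `c`, `∏c_ℓ` odd ⟹ `ord₂ #Ш_an(V) = 2M₀ = ord₂ #Ш(V)`,
i.e. `MissingPPartOverCAt V 2`; the model-free descent `AdditivePotMult.bsdp_of_pPartOverC_baseChange`
(Milne any-model: every stray `2`-power of the item's «why it might fail» — `Ω(E_K/K)` vs
`Ω_E·Ω_{E^D}`, `[E(K):E(ℚ)+E^D(ℚ)]`, Kramer's local norm indices — cancels inside ONE whole-quotient
identity; Kramer 1981 never enters) gives `BSD₂(W)` from `BSD₂(Wd)`.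

CONSEQUENCE FOR THE LINE (census): crux #4 is PRINT-COMPLETE — its open content is nil beyond the five
named facts (all published theorems) — so the line's research content is crux #2 (supply), crux #3
(exactness at 2) and crux #6 (the twin's BSD₂); the registered stub `stub_twoAdicValuationAtTwo` of
my skeleton `Lines/birth` is discharged CONDITIONALLY by `stub_twoAdicValuationAtTwo_of_facts` below.

References: [GrossZagier1986] I.(6.3), V.§2; [GrossLMS1991] §1 (1.2), §2 Conj. (2.2), §4 (4.1), Thm 1.3;
[Kolyvagin1990] Thm A; [McCallumLMS1991] §5 Lemma 5.1; [Milne1972ArithmeticAV] §1 Thm 1;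
[DokchitserDokchitserAnnals2010] §2.1; [Miller2011LMS] Def. 1.1.
-/

set_option autoImplicit false
-- the Theorems namespace of this sub repeats the summit name by design (D-0017 nested layout)
set_option linter.dupNamespace false

noncomputable section

open scoped Classical

open WeierstrassCurve NumberField Literature.NumberTheory.EllipticCurves
  Literature.NumberTheory.EllipticCurves.ModularForms
  Literature.NumberTheory.EllipticCurves.Rank1Residual
  Literature.NumberTheory.EllipticCurves.Rank1Residual.Typed
  Literature.NumberTheory.EllipticCurves.KrizLi2019
  Summit.BirchSwinnertonDyer.Rank1Residual
  Summit.BirchSwinnertonDyer.Rank1Residual.AdditivePotMult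
  Summit.BirchSwinnertonDyer.BirchSwinnertonDyer.Theorems.CMExactDescent

namespace Summit.BirchSwinnertonDyer.BirchSwinnertonDyer.Theorems.GenusExactDescent

/-- **The twin of the rank-zero member has analytic rank EXACTLY one.** `W/ℚ` globally minimal with
`ord_{s=1} L(E,s) = 0`, `K` imaginary quadratic with the Heegner hypothesis for `N_E`, `P₀ ∈ E(K)` a
Heegner point (of a datum at level `N_E`) of infinite order; binders `hGZ`, `hKo`, `hGZK`, `hmod`.
Then `ord_{s=1} L(E^{(d_K)}, s) = 1`: Gross–Zagier gives `L′(E/K,1) ≠ 0`; Kolyvagin `rank E(K) = 1`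
and GZK `rank E(ℚ) = 0` give `rank E^{(d_K)}(ℚ) = 1`, so `L(E^{(d_K)},1) = 0` (GZK again); then
`L′(E/K,1) = L(E,1)·L′(E^{(d_K)},1) ≠ 0` makes the zero simple. [cite: GrossZagier1986, Thm. I.6.3 and V.§2]
[cite: Kolyvagin1990, Thm. A] [cite: Darmon2004, Thm. 3.22] -/
theorem analyticRank_twist_eq_one_of_rankZero
    (W : WeierstrassCurve ℚ) [W.IsElliptic] [W.IsGloballyMinimal] [NeZero (W.conductorNorm ℤ)]
    (K : Type) [Field K] [NumberField K]
    (hGZ : gross_zagier (W.conductorNorm ℤ) W K) (hKo : kolyvagin (W.conductorNorm ℤ) W K)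
    (hGZK : rank_eq_analyticRank_of_analyticRank_le_one) (hmod : hasEntireLFunction_rat)
    (hK : IsImaginaryQuadratic K) (hH : SatisfiesHeegnerHypothesis (W.conductorNorm ℤ) K)
    (hr0 : W.analyticRank = 0) {P₀ : (W.baseChange K).toAffine.Point}
    (hP₀ : IsHeegnerPoint (W.conductorNorm ℤ) W K P₀) (hPinf : ¬ IsOfFinAddOrder P₀) :
    (W.quadraticTwist (NumberField.discr K : ℚ)).analyticRank = 1 := by
  haveI hEK : (W.baseChange K).IsElliptic := isElliptic_baseChange' W K
  have h2 : Module.finrank ℚ K = 2 := hK.1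
  have hD0 : (NumberField.discr K : ℚ) ≠ 0 := by exact_mod_cast NumberField.discr_ne_zero K
  haveI hEt : (W.quadraticTwist (NumberField.discr K : ℚ)).IsElliptic :=
    W.isElliptic_quadraticTwist hD0
  have hLK : LDerivEK W K ≠ 0 :=
    (lDerivEK_ne_zero_iff_not_isOfFinAddOrder W (W.conductorNorm ℤ) K hGZ hK hH hP₀).mpr hPinf
  obtain ⟨hrkK, -⟩ := hKo hK hH hP₀ hPinf
  have hrankW : W.mordellWeilRank = 0 := by
    have h := (hGZK W (by rw [hr0]; exact zero_le_one)).1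
    rw [h, hr0]
  have hsum := mordellWeilRank_baseChange_quadratic_holds W K h2
  have hrankt : (W.quadraticTwist (NumberField.discr K : ℚ)).mordellWeilRank = 1 := by omega
  have hLt0 : (W.quadraticTwist (NumberField.discr K : ℚ)).entireLFunction 1 = 0 := by
    by_contra hne
    have hrt0 : (W.quadraticTwist (NumberField.discr K : ℚ)).analyticRank = 0 :=
      ((W.quadraticTwist _).analyticRank_eq_zero_iff_holds (hmod _)).mpr hne
    have h := (hGZK (W.quadraticTwist (NumberField.discr K : ℚ)) (by rw [hrt0]; exact zero_le_one)).1
    omega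
  have hder : deriv (W.quadraticTwist (NumberField.discr K : ℚ)).entireLFunction 1 ≠ 0 := by
    intro hd
    apply hLK
    rw [AnticyclotomicRankZero.lDerivEK_eq_mul_deriv hmod W K hLt0, hd, mul_zero]
  exact analyticRank_eq_one_of_entireLFunction_one_eq_zero_of_deriv_ne_zero _ (hmod _) hLt0 hder

/-! ## The crux, closed modulo the five published facts -/

/-- **`ExactDescentAtTwo` MODULO ITS FIVE PUBLISHED INPUTS** `hGZ` (Gross–Zagier, all `(N, W, K)`),
`hKo` (Kolyvagin, all `(N, W, K)`), `hGZK` (Gross–Zagier–Kolyvagin over `ℚ`), `hmod` (modularity),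
`hMilneC` (Milne 1972 Thm 1, any model). For the rank-ZERO member `E` of the Heegner pair: §2–§4 of the
CM sibling file give `P₀ ∈ E(K)` below `P(1)`, `E(K[1])[2] = 0`, `ord₂[E(K):ℤP₀] = M₀` and
`#Ш_an(W ⊗ K) = 4I²/(c²·w_K²·(∏c_ℓ)²)`; here `ord_{s=1} L(E^{(d_K)},s) = 1`
(`analyticRank_twist_eq_one_of_rankZero`), so `ord_{s=1} L(E_K,s) = 1`; `w_K = 2`, `c` and `∏c_ℓ`
odd give `ord₂ #Ш_an(W ⊗ K) = 2M₀ = ord₂ #Ш(W ⊗ K)` (exactness input), i.e. `MissingPPartOverCAt (W ⊗ K) 2`,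
and `AdditivePotMult.bsdp_of_pPartOverC_baseChange` concludes `BSD(W, 2)` from `BSD(Wd, 2)`. The
non-CM hypothesis, `#Sel₂(Wd) = 2` and the optimality display are not used. CONDITIONAL on the five
named facts (none has a `_holds`); closes item 22138 only through an `…OfFacts` twin.
[cite: GrossZagier1986, V.§2 (pp. 310–312)] [cite: Milne1972ArithmeticAV, §1 Thm. 1]
[cite: McCallumLMS1991, §5 Lemma 5.1] [cite: Kolyvagin1990, Thm. A] [cite: Miller2011LMS, Def. 1.1] -/
theorem exactDescentAtTwo_of_facts
    (hGZ : ∀ (N : ℕ) [NeZero N] (W : WeierstrassCurve ℚ) (K : Type) [Field K] [NumberField K],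
      gross_zagier N W K)
    (hKo : ∀ (N : ℕ) [NeZero N] (W : WeierstrassCurve ℚ) (K : Type) [Field K] [NumberField K],
      kolyvagin N W K)
    (hGZK : rank_eq_analyticRank_of_analyticRank_le_one) (hmod : hasEntireLFunction_rat)
    (hMilneC : Milne1972.bsdQuotient_baseChange_quadratic_anyModel) :
    Summit.BirchSwinnertonDyer.BirchSwinnertonDyer.Theses.GenusKolyvaginAtTwo.ExactDescentAtTwo := by
  intro W _ _ _ _hcm hr0 hρ hT K _ _ hK hodd h3 hH Dt _hopt hc β ι d₁ hy M₀ hdiv hndiv hsha Wd _ _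
    hWd _hSel hBd
  haveI : Fact (Nat.Prime 2) := ⟨Nat.prime_two⟩
  haveI hEK : (W.baseChange K).IsElliptic := isElliptic_baseChange' W K
  have h2 : Module.finrank ℚ K = 2 := hK.1
  have hD0 : (NumberField.discr K : ℚ) ≠ 0 := by exact_mod_cast NumberField.discr_ne_zero K
  haveI hEt : (W.quadraticTwist (NumberField.discr K : ℚ)).IsElliptic :=
    W.isElliptic_quadraticTwist hD0
  obtain ⟨hD4, hDlt⟩ := discr_emod_four_and_lt_of_odd hK hodd h3
  have hw2 : Units.torsionOrder K = 2 :=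
    Literature.NumberTheory.QuadraticFields.Quadratic.torsionOrder_eq_two_of_discr_lt_neg_four h2 hDlt
  have hc0 : Dt.c ≠ 0 := by
    obtain ⟨k, hk⟩ := hc
    omega
  have hρ2 : W.HasSurjectiveModNGaloisRep 2 := by
    simpa using hρ 1 one_pos
  -- §2: the Heegner point `P₀ ∈ E(K)` below `P(1)`, for the item's own `Dt`
  obtain ⟨P₀, Hd, hP₀, hP₀K⟩ := exists_heegnerPoint_map_eq_derivedPoint_one hK hH d₁
  have hPinf : ¬ IsOfFinAddOrder P₀ := by
    intro hfin
    apply hy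
    rw [← hP₀K]
    exact (WeierstrassCurve.Affine.Point.map (W' := W)
      (algebraMap K (ringClassField K ι 1)).toRatAlgHom).isOfFinAddOrder hfin
  -- ranks: `E` has analytic rank `0` (hypothesis), the twin analytic rank exactly `1`
  have hrt : (W.quadraticTwist (NumberField.discr K : ℚ)).analyticRank = 1 :=
    analyticRank_twist_eq_one_of_rankZero W K (hGZ _ W K) (hKo _ W K) hGZK hmod hK hH hr0
      ⟨Dt, Hd, ι, hP₀⟩ hPinf
  have hrd : Wd.analyticRank = 1 := by
    obtain ⟨Cd, hCd⟩ := hWd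
    rw [← hCd, analyticRank_smul, hrt]
  have hrK : (W.baseChange K).analyticRank = 1 :=
    (P2.analyticRank_baseChange_eq_one_iff W K hmod h2).mpr (Or.inr ⟨hr0, hrt⟩)
  -- §4: the exact identity over `K`
  obtain ⟨hrkK, hShaK, -, hshaC⟩ := shaAnOverC_baseChange_eq_of_heegner W K Dt Hd ι P₀ (hGZ _ W K)
    hGZK hmod hK hH hP₀ hc0 hrK
  haveI hfinK : Finite (W.baseChange K).sha := hShaK
  -- §3: `ord₂ [E(K) : ℤP₀] = M₀`
  have htor1 : ∀ (M : ℕ) (R : (W.baseChange (ringClassField K ι 1)).toAffine.Point),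
      ((2 ^ M : ℕ) : ℤ) • R = 0 → R = 0 :=
    fun M R hR ↦ eq_zero_of_two_pow_smul_eq_zero_ringClassField W hK hodd hH hρ2 ι M R hR
  have hdivK : ∃ Q : (W.baseChange K).toAffine.Point, ((2 ^ M₀ : ℕ) : ℤ) • Q = P₀ :=
    (X11b.Three.Koly.pDiv_one_iff_exists_zsmul_eq hK d₁ P₀ hP₀K 2 M₀ (htor1 M₀)).mp hdiv
  have hndivK : ¬ ∃ Q : (W.baseChange K).toAffine.Point, ((2 ^ (M₀ + 1) : ℕ) : ℤ) • Q = P₀ :=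
    fun h ↦ hndiv ((X11b.Three.Koly.pDiv_one_iff_exists_zsmul_eq hK d₁ P₀ hP₀K 2 (M₀ + 1)
      (htor1 (M₀ + 1))).mpr h)
  have hiv : ∀ x : (W.baseChange K).toAffine.Point, 2 • x = 0 → x = 0 :=
    fun x hx ↦ eq_zero_of_two_smul_eq_zero_baseChange W hK hodd hH hρ2 x hx
  haveI : Finite (AddCommGroup.torsion (W.baseChange K).toAffine.Point) :=
    WeierstrassCurve.finite_torsion_point (W := W.baseChange K)
  obtain ⟨cc, Q, hcQ, hcker⟩ :=
    X11b.RankOne.exists_coord_of_mordellWeilRank_eq_one (W.baseChange K) hrkK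
  have hidx : padicValNat 2 (AddSubgroup.zmultiples P₀).index = M₀ :=
    X11b.Three.Koly.padicValNat_index_zmultiples_eq_of_divisibility (p := 2) cc Q hcQ hcker hiv P₀
      hdivK hndivK
  -- §5: `ord₂ #Ш_an(W ⊗ K) = 2 M₀ = ord₂ #Ш(W ⊗ K)`
  set I := (AddSubgroup.zmultiples P₀).index with hI_def
  have hI0 : I ≠ 0 := fun hI ↦ by
    have hh := P2.torsionOrder_sq_mul_canonicalHeight_eq_index_sq_mul_regulator (W.baseChange K)
      hrkK P₀ hPinf
    rw [← hI_def, hI, Nat.cast_zero, zero_pow two_ne_zero, zero_mul, mul_eq_zero,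
      pow_eq_zero_iff two_ne_zero, Nat.cast_eq_zero] at hh
    exact hh.elim (W.baseChange K).torsionOrder_pos_holds.ne'
      (fun h0 ↦ hPinf ((Affine.Point.canonicalHeight_eq_zero_iff_holds P₀).mp h0))
  set q : ℚ := 4 * (I : ℚ) ^ 2 /
      ((Dt.c : ℚ) ^ 2 * (Units.torsionOrder K : ℚ) ^ 2 * ((W.tamagawaProduct : ℚ) ^ 2)) with hq_def
  have hcQ0 : (Dt.c : ℚ) ≠ 0 := by exact_mod_cast hc0
  have hcW0 : (W.tamagawaProduct : ℚ) ≠ 0 := by exact_mod_cast W.tamagawaProduct_pos_holds.ne'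
  have hIQ0 : (I : ℚ) ≠ 0 := by exact_mod_cast hI0
  have hq' : q = ((I : ℚ) / ((Dt.c : ℚ) * (W.tamagawaProduct : ℚ))) ^ 2 := by
    rw [hq_def, hw2]
    push_cast
    field_simp
    ring
  have hvc : padicValRat 2 (Dt.c : ℚ) = 0 := by
    rw [padicValRat.of_int, padicValInt.eq_zero_of_not_dvd (fun h2c ↦
      (Int.not_even_iff_odd.mpr hc) (even_iff_two_dvd.mpr h2c))]
    rfl
  have hvcW : padicValRat 2 (W.tamagawaProduct : ℚ) = 0 := by
    rw [padicValRat.of_nat, padicValNat.eq_zero_of_not_dvd hT.not_two_dvd_nat]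
    rfl
  have hval : padicValRat 2 q = 2 * (M₀ : ℤ) := by
    rw [hq', padicValRat.pow, padicValRat.div hIQ0 (mul_ne_zero hcQ0 hcW0),
      padicValRat.mul hcQ0 hcW0, hvc, hvcW, padicValRat.of_nat, hidx]
    push_cast
    ring
  have hshaV : padicValNat 2 (W.baseChange K).shaOrder = 2 * M₀ := by
    rw [X11b.Three.Koly.padicValNat_shaOrder_eq (W.baseChange K) 2, hsha, padicValNat.prime_pow]
  have hKin : MissingPPartOverCAt (W.baseChange K) 2 :=
    ⟨q, hshaC, by rw [hval, hshaV]; push_cast; ring⟩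
  exact bsdp_of_pPartOverC_baseChange W 2 K Wd hGZK hmod hMilneC (by rw [hr0]; exact zero_le_one) h2
    hWd (by rw [hrd]) hKin hBd

/-- **The crux RELATIVE TO its named-fact bundle** (`…OfFacts` shape, as for the CM sibling 22837):
`(∀ N W K, gross_zagier N W K) ∧ (∀ N W K, kolyvagin N W K) ∧ GZK ∧ modularity ∧ Milne any-model →
ExactDescentAtTwo` — the statement a by-name closer can prove. [cite: Miller2011LMS, Def. 1.1] -/
theorem exactDescentAtTwo_ofFacts :
    ((∀ (N : ℕ) [NeZero N] (W : WeierstrassCurve ℚ) (K : Type) [Field K] [NumberField K],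
        gross_zagier N W K) ∧
      (∀ (N : ℕ) [NeZero N] (W : WeierstrassCurve ℚ) (K : Type) [Field K] [NumberField K],
        kolyvagin N W K) ∧
      rank_eq_analyticRank_of_analyticRank_le_one ∧ hasEntireLFunction_rat ∧
      Milne1972.bsdQuotient_baseChange_quadratic_anyModel) →
    Summit.BirchSwinnertonDyer.BirchSwinnertonDyer.Theses.GenusKolyvaginAtTwo.ExactDescentAtTwo :=
  fun h ↦ exactDescentAtTwo_of_facts h.1 h.2.1 h.2.2.1 h.2.2.2.1 h.2.2.2.2


/-! ## Append: the registered valuation stub of the skeleton `Lines/birth`, conditionally -/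

/-- **The registered stub `stub_twoAdicValuationAtTwo` of crux `ExactDescentAtTwo` (skeleton
`Lines/birth`, seat `bsd-line-gk2-p3`) MODULO THE FIVE PUBLISHED FACTS**: its signature verbatim —
under every hypothesis of the crux, `#Ш(E/ℚ)_an` is a rational `q` with `ord₂ q = ord₂ #Ш(E/ℚ)[2^∞]`
— read off clause (iii)∧(iv) of `BSD(W, 2)` given by `exactDescentAtTwo_of_facts`. CONDITIONAL
(credits nothing by itself); recorded so that the stub ledger of 22138 shows R (conditional on GZK,
`stub_rankZeroAtTwo_of_GZK`), F (landed), V (conditional on the five facts).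
[cite: Miller2011LMS, Def. 1.1 (arXiv:1010.2431 p. 3)] [cite: GrossZagier1986, V.(2.2)] -/
theorem stub_twoAdicValuationAtTwo_of_facts
    (hGZ : ∀ (N : ℕ) [NeZero N] (W : WeierstrassCurve ℚ) (K : Type) [Field K] [NumberField K],
      gross_zagier N W K)
    (hKo : ∀ (N : ℕ) [NeZero N] (W : WeierstrassCurve ℚ) (K : Type) [Field K] [NumberField K],
      kolyvagin N W K)
    (hGZK : rank_eq_analyticRank_of_analyticRank_le_one) (hmod : hasEntireLFunction_rat)
    (hMilneC : Milne1972.bsdQuotient_baseChange_quadratic_anyModel) :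
    ∀ (W : WeierstrassCurve ℚ) [W.IsElliptic] [W.IsGloballyMinimal] [NeZero (W.conductorNorm ℤ)],
      ¬ W.HasCM → W.analyticRank = 0 →
      (∀ n : ℕ, 0 < n → W.HasSurjectiveModNGaloisRep ((2 : ℤ) ^ n)) → Odd W.tamagawaProduct →
      ∀ (K : Type) [Field K] [NumberField K], IsImaginaryQuadratic K → Odd (NumberField.discr K) →
      NumberField.discr K ≠ -3 → SatisfiesHeegnerHypothesis (W.conductorNorm ℤ) K →
      ∀ (Dt : ModularParametrizationData W (W.conductorNorm ℤ)),
      (∀ z ∈ Dt.L.lattice, ∃ w ∈ periodLattice Dt.f, z = (Dt.c : ℂ) * w) → Odd Dt.c →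
      ∀ (β : ℤ) (ι : K →+* ℂ) (d₁ : KolyvaginHeegnerData Dt β ι 1), ¬ IsOfFinAddOrder d₁.derivedPoint →
      ∀ (M₀ : ℕ),
        (∃ Q : (W.baseChange (ringClassField K ι 1)).toAffine.Point,
          ((2 ^ M₀ : ℕ) : ℤ) • Q = d₁.derivedPoint) →
        (¬ ∃ Q : (W.baseChange (ringClassField K ι 1)).toAffine.Point,
          ((2 ^ (M₀ + 1) : ℕ) : ℤ) • Q = d₁.derivedPoint) →
        Nat.card (AddCommGroup.primaryComponent (W.baseChange K).sha 2) = 2 ^ (2 * M₀) →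
      ∀ (Wd : WeierstrassCurve ℚ) [Wd.IsElliptic] [Wd.IsGloballyMinimal],
        (∃ C : WeierstrassCurve.VariableChange ℚ, C • W.quadraticTwist (NumberField.discr K : ℚ) = Wd) →
        Nat.card (Wd.selmerGroup 2) = 2 → BSDp Wd 2 →
        ∃ q : ℚ, shaAn W = (q : ℂ) ∧
          padicValRat 2 q = padicValNat 2 (Nat.card (AddCommGroup.primaryComponent W.sha 2)) := by
  intro W _ _ _ hcm hr0 hρ hT K _ _ hK hodd h3 hH Dt hopt hc β ι d₁ hy M₀ hdiv hndiv hsha Wd _ _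
    hWd hSel hBd
  exact (exactDescentAtTwo_of_facts hGZ hKo hGZK hmod hMilneC W hcm hr0 hρ hT K hK hodd h3 hH Dt hopt hc
    β ι d₁ hy M₀ hdiv hndiv hsha Wd hWd hSel hBd).2.2

end Summit.BirchSwinnertonDyer.BirchSwinnertonDyer.Theorems.GenusExactDescent

end
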